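import Summits.QuantumFields.YangMills.Theorems.AllWindowsColdBoxBoxHighLineSmearedFPOrbit
import Summits.QuantumFields.YangMills.Theorems.AllWindowsColdBoxBoxHighLineSmearedFPWeight

/-!
# T-S5.4ℓ (task statement, planner ym-idea-2 g17): `LandauBallCoercivity` — the QUANTITATIVE form of U3
# (Gribov uniqueness ⇒ coercivity of the gauge-fixing functional on the gauge ball)

STEP (1b) of S5/U5, FAR-REGION control of the smeared Faddeev–Popov integral (see `SHELL-BUDGET-S5U5.md` in this crux
directory): on the support of the ball cut-off, the Gaussian functional `landauPhi` of `W = U^{g'}` is bounded BELOW by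
`c·H⁻⁴·Σ_x gaugeDist g g' x` whenever `V = U^{g}` is the Landau representative — so the region of the orbit at distance `≥ ρ`
from the representative carries weight `≤ exp(−c β ρ² / H⁴)`.

PROOF ROUTE (M, deterministic; = the proof of ✓`stub_landauBallUniqueness` (…LandauBallUniqueness.lean) with «= 0» replaced by
Cauchy–Schwarz): with `h = g'·g⁻¹`, `ψ_x = q(h_x)`, `φ_x = Im ψ_x` (vanishing off the interior), steps (1)–(3) of U3 give
`(1/2)·D ≤ Σ_{e ∈ box} ⟪φ_x − φ_y, Im q(W_e) − Im q(V_e)⟫` for `r·H ≤ 1/32` (`D = Σ_e ‖φ_x − φ_y‖²`; ✓`edge_pairing_lower_sq`,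
✓`sum_edges_endpoints_le`, ✓`sum_norm_sq_le_poincare`); summation by parts (✓`sum_inner_div_eq_sum_edges`) rewrites the right side as
`−Σ_x ⟪φ_x, D_W(x) − D_V(x)⟫` with `D_·(x) = Σ_μ (Im q(·)(x−e_μ,μ) − Im q(·)(x,μ))`; `D_V ≡ 0` on the interior (✓`sum_im_su2Quat_eq_of_inLandauGauge`)
and `D_W(x)` is (a fixed multiple of) `divDefect W x` (✓`im_su2Quat_eq_of_sub_conjTranspose`, ✓`divDefect_apply`), so by Cauchy–Schwarz
`(1/2)·D ≤ κ·‖φ‖₂·√(landauPhi H W)`; with Poincaré `‖φ‖₂² ≤ 4H²·D`: `‖φ‖₂ ≤ 8κH²·√(landauPhi H W)`, i.e. `Σ_x ‖Im ψ_x‖² ≤ 64κ²H⁴·landauPhi H W`;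
finally `gaugeDist g g' x = ‖ψ_x − 1‖² = 2(1 − Re ψ_x) ≤ (16/15)‖Im ψ_x‖²` since `Re ψ_x ≥ 7/8` (U3 step (1), ✓`one_sub_norm_le_re`).

HONEST LABEL: a task STATEMENT (Prop only); S5/U5, ⟨24004⟩ ⟨24335⟩ ⟨24336⟩ OPEN; no summit (YM mass gap) is proved by any line.
-/

set_option autoImplicit false

noncomputable section

open Literature.MathematicalPhysics.QuantumFieldTheory.AxialGauge (boxEdges)
open Literature.MathematicalPhysics.QuantumLattice (gaugeTransformZd LGConfig)
open Literature.Probability.LatticeModels (Site)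

namespace Summit.QuantumFields.YangMills.Theorems.AllWindowsColdBoxBoxHighLine

/-- **T-S5.4ℓ `LandauBallCoercivity` (M).** Quantitative Gribov uniqueness: if `U^g` is in lattice Landau gauge and both `U^g`, `U^{g'}`
(interior `g, g'`) have all cold-box links within defect `r²` of the identity, `r·H ≤ c₀`, then
`c·Σ_{x ∈ interior} gaugeDist g g' x ≤ H⁴ · landauPhi H (U^{g'})`.  (U3 is the case `landauPhi = 0`.) -/
def LandauBallCoercivity : Prop :=
  ∃ c₀ c : ℝ, 0 < c₀ ∧ 0 < c ∧ ∀ H : ℕ, 1 ≤ H → ∀ r : ℝ, 0 ≤ r → r * H ≤ c₀ →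
    ∀ (U : LGConfig 4 SU2) (g g' : Site 4 → SU2), IsInteriorGauge H g → IsInteriorGauge H g' →
      (∀ e ∈ boxEdges 4 (2 * H + 1), linkDefect (gaugeTransformZd g U) e ≤ r ^ 2) →
      (∀ e ∈ boxEdges 4 (2 * H + 1), linkDefect (gaugeTransformZd g' U) e ≤ r ^ 2) →
      InLandauGauge H (gaugeTransformZd g U) →
        c * ∑ x ∈ interiorSites H, gaugeDist g g' x ≤ (H : ℝ) ^ 4 * landauPhi H (gaugeTransformZd g' U)

end Summit.QuantumFields.YangMills.Theorems.AllWindowsColdBoxBoxHighLine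

end
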